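import Summits.FinalStateConjecture.FinalStateConjecture.Theses.EIHFluxBalance
import Summits.FinalStateConjecture.FinalStateConjecture.Theses.RobustClausewiseGenericity
import Summits.FinalStateConjecture.FinalStateConjecture.Theorems.EIHFluxBalanceModulatedKerrHandoffTrimCompositions
import Literature.Geometry.Lorentzian.FinalEraPackage2

/-!
# Sketch — crux-ideate round 2, ideator 5, crux `EIHFluxBalance.ModulatedKerrHandoff` (H′, item
stmt-FinalStateConjecture-17402)

Two idea cards, two namespaces. Everything is a `def … : Prop` (no `sorry`) except the one
composition theorem `ClausewiseRobustEra.modulatedKerrHandoff_of_clausewise`, which is PROVED from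
the landed plumbing (`exists_tameCurve_of_kick_trim`, `modulatedKerrHandoff_of_tameEscapeExists`).

* `ClausewiseRobustEra` (card `clausewise-robust-era`): the genericity content of H′ cut CLAUSE-WISE in
  the robust-escape format of route RobustClausewiseGenericity — censorship (that route's item 10131,
  by name), a rev-2 FINAL ERA (route DissipativeFinalMotions' `FinalEraPackage₂` clause), and the
  H′-proper HYPERBOLIC-PAIRS wall — assembled into one-sided local kick families
  (`KicksWithConjunction`, the shape of hypothesis `hC` of the landed `modulatedKerrHandoff_of_core_trim`),
  then trimmed and lifted pointwise (`SoftEraLift`, the shape of `hU`).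
* `SoftEraTubeLift` (card `soft-era-tube-lift`): the first checkable statement of the lift's far-cone
  engine — the Liénard–Wiechert retardation remainder of the instantaneous-boost ansatz.
-/

set_option linter.dupNamespace false
set_option linter.style.longLine false

noncomputable section

namespace Summit.FinalStateConjecture.FinalStateConjecture.Cruxes.ModulatedKerrHandoff

open scoped BigOperators Topology Manifold Classical ContDiff ENNReal
open Filter Set Function TopologicalSpace MeasureTheory Literature.Geometry.Lorentzian InitialDataSet
open Summit.FinalStateConjecture.FinalStateConjecture.Theorems.EIHFluxBalance.TameTemplate

/-! ## Card 1 — `clausewise-robust-era` -/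

namespace ClausewiseRobustEra

section Defs

variable (X : Type) [TopologicalSpace X] [ChartedSpace E3 X] [IsManifold (𝓡 3) ((⊤ : ℕ∞) : WithTop ℕ∞) X]
  [T2Space X] [SecondCountableTopology X] [ConnectedSpace X]

/-- A TAME `m`-PROBE through `d` (verbatim the `Tame` legend of route RobustClausewiseGenericity):
jointly smooth, `G 0 = d`, every member admissible, equal to `d` off ONE compact set. -/
def TameProbe (d : InitialDataSet (𝓡 3) X) (m : ℕ)
    (G : EuclideanSpace ℝ (Fin m) → InitialDataSet (𝓡 3) X) : Prop :=
  IsSmoothDataFamily m G ∧ G 0 = d ∧ (∀ c, G c ∈ admissibleVacuumData X) ∧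
    ∃ K : Set X, IsCompact K ∧ ∀ c, ∀ x ∉ K, (G c).h.inner x = d.h.inner x ∧ (G c).k x = d.k x

/-- `Q` is ROBUSTLY ESCAPABLE at `d` (verbatim the legend of route RobustClausewiseGenericity): every
tame probe through `d` enriches to one along all of whose further tame enrichments an open dense set of
radial directions satisfies `Q` for all small non-zero parameters. -/
def RobustlyEscapable (Q : InitialDataSet (𝓡 3) X → Prop) (d : InitialDataSet (𝓡 3) X) : Prop :=
  ∀ (m : ℕ) (G : EuclideanSpace ℝ (Fin m) → InitialDataSet (𝓡 3) X), TameProbe X d m G →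
    ∃ (n : ℕ) (G₁ : EuclideanSpace ℝ (Fin n) → InitialDataSet (𝓡 3) X)
      (L : EuclideanSpace ℝ (Fin m) →ₗ[ℝ] EuclideanSpace ℝ (Fin n)),
      Injective L ∧ TameProbe X d n G₁ ∧ (∀ c, G₁ (L c) = G c) ∧
        ∀ (p : ℕ) (G₂ : EuclideanSpace ℝ (Fin p) → InitialDataSet (𝓡 3) X)
          (L' : EuclideanSpace ℝ (Fin n) →ₗ[ℝ] EuclideanSpace ℝ (Fin p)),
          Injective L' → TameProbe X d p G₂ → (∀ c, G₂ (L' c) = G₁ c) →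
            ∃ U : Set (EuclideanSpace ℝ (Fin p)), IsOpen U ∧ Dense U ∧
              ∀ v ∈ U, ∃ δ : ℝ, 0 < δ ∧ ∀ t : ℝ, t ≠ 0 → |t| < δ → Q (G₂ (t • v))

/-- Clause (B): every MGHD of `D` has complete `𝓘⁺` (sojourn form). -/
def CensoredProp (D : InitialDataSet (𝓡 3) X) : Prop :=
  ∀ 𝒟 : VacuumCauchyDevelopment D, 𝒟.IsMaximal →
    Summit.FinalStateConjecture.HasCompleteNullInfinity 𝒟.toCauchyDevelopment

/-- Clause (E), the SOFT MODULATED CORE: every MGHD of `D` carries a rev-2 final-era package (the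
31-clause `FinalEraPackage₂` of route DissipativeFinalMotions: sub-extremal labels, separation floor,
speed bound, EIH modulation law with `L¹` slack, flat chart `C² → η`, `1 %` near-zone pin, effacement,
exhaustion, anti-twin) — no rates, no weights, no common lab chart, no handoff clauses. -/
def EraProp (D : InitialDataSet (𝓡 3) X) : Prop :=
  ∀ 𝒟 : VacuumCauchyDevelopment D, 𝒟.IsMaximal → Nonempty (FinalEraPackage₂ 𝒟.toCauchyDevelopment)

/-- Clause (H), the H′-PROPER WALL: in every era package of every MGHD of `D`, distinct worldlines
separate LINEARLY in flat-chart time (hyperbolic final motions; parabolic `t^{2/3}` pairs — BN1's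
`m = 0` obstruction — are exactly what fails it). Vacuous where no era exists. -/
def HyperbolicProp (D : InitialDataSet (𝓡 3) X) : Prop :=
  ∀ 𝒟 : VacuumCauchyDevelopment D, 𝒟.IsMaximal →
    ∀ (p : FinalEraPackage₂ 𝒟.toCauchyDevelopment) (i j : Fin p.N), i ≠ j →
      ∃ v : ℝ, 0 < v ∧ ∀ᶠ t in atTop, v * t ≤ ‖p.ξ i t - p.ξ j t‖

/-- The conjunction handed to the lift. -/
def ConjProp (D : InitialDataSet (𝓡 3) X) : Prop :=
  CensoredProp X D ∧ EraProp X D ∧ HyperbolicProp X D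

end Defs

/-- CENSORSHIP IS ROBUSTLY ESCAPABLE — literally item stmt-FinalStateConjecture-10131 of route
RobustClausewiseGenericity (see `censorshipRobust'_iff`); imported, not re-filed. -/
def CensorshipRobust' : Prop :=
  ∀ (X : Type) [TopologicalSpace X] [ChartedSpace E3 X] [IsManifold (𝓡 3) ((⊤ : ℕ∞) : WithTop ℕ∞) X]
    [T2Space X] [SecondCountableTopology X] [ConnectedSpace X],
    ∀ d ∈ admissibleVacuumData X, RobustlyEscapable X (CensoredProp X) d

/-- THE ERA IS ROBUSTLY ESCAPABLE (new item; the era clause of DissipativeFinalMotions'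
`FinalEraGeneric`, item 17642, in robust format; shareable). -/
def EraRobust : Prop :=
  ∀ (X : Type) [TopologicalSpace X] [ChartedSpace E3 X] [IsManifold (𝓡 3) ((⊤ : ℕ∞) : WithTop ℕ∞) X]
    [T2Space X] [SecondCountableTopology X] [ConnectedSpace X],
    ∀ d ∈ admissibleVacuumData X, RobustlyEscapable X (EraProp X) d

/-- THE PARABOLIC WALL IS ROBUSTLY ESCAPABLE (new item; H′-proper). -/
def HyperbolicRobust : Prop :=
  ∀ (X : Type) [TopologicalSpace X] [ChartedSpace E3 X] [IsManifold (𝓡 3) ((⊤ : ℕ∞) : WithTop ℕ∞) X]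
    [T2Space X] [SecondCountableTopology X] [ConnectedSpace X],
    ∀ d ∈ admissibleVacuumData X, RobustlyEscapable X (HyperbolicProp X) d

/-- Faithfulness: `CensorshipRobust'` IS route RobustClausewiseGenericity's `CensorshipRobust`. -/
theorem censorshipRobust'_iff :
    CensorshipRobust' ↔ Theses.RobustClausewiseGenericity.CensorshipRobust := Iff.rfl

/-- OUTPUT OF THE CONJUNCTION STEP: through EVERY admissible datum a one-sided local kick family whose
small positive members satisfy the conjunction — exactly hypothesis `hC` of the landed
`modulatedKerrHandoff_of_core_trim` with `CoreHandoffProp` replaced by `ConjProp`. -/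
def KicksWithConjunction : Prop :=
  ∀ (X : Type) [TopologicalSpace X] [ChartedSpace E3 X] [IsManifold (𝓡 3) ((⊤ : ℕ∞) : WithTop ℕ∞) X]
    [T2Space X] [SecondCountableTopology X] [ConnectedSpace X],
    ∀ d ∈ admissibleVacuumData X,
      ∃ G : EuclideanSpace ℝ (Fin 1) → InitialDataSet (𝓡 3) X, IsLocalKick X d G ∧
        ∃ δ : ℝ, 0 < δ ∧ ∀ c : EuclideanSpace ℝ (Fin 1), 0 < c 0 → c 0 < δ → ConjProp X (G c)

/-- THE CONJUNCTION GLUE (provable now; the general-position pattern of steps (1), (3), (4) of route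
RobustClausewiseGenericity's deciding theorem, without its gauge step — immersion and injectivity are
supplied downstream by `modulatedKerrHandoff_of_tameEscapeExists`): start from the constant `0`-probe,
enrich thrice, intersect the three open dense direction sets, restrict to a ray. -/
def ConjunctionGlue : Prop :=
  CensorshipRobust' → EraRobust → HyperbolicRobust → KicksWithConjunction

/-- **THE CONJUNCTION GLUE HOLDS** (general position, proved): enrich the constant `0`-probe three
times (censorship, era, wall), read the three open dense direction sets on the last probe, pick a
common direction `v`, and take the ray `c ↦ G₃((c 0)·v)`. [folklore] -/
theorem conjunctionGlue : ConjunctionGlue := by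
  intro hB hE hH X _ _ _ _ _ _ d hd
  -- the constant `0`-probe through `d`
  have h0 : TameProbe X d 0 (fun _ ↦ d) :=
    ⟨isSmoothDataFamily_const 0 d, rfl, fun _ ↦ hd, ∅, isCompact_empty, fun _ _ _ ↦ ⟨rfl, rfl⟩⟩
  -- three successive enrichments
  obtain ⟨n₁, G₁, L₁, -, hG₁, -, R₁⟩ := hB X d hd 0 (fun _ ↦ d) h0
  obtain ⟨n₂, G₂, L₂, hL₂, hG₂, hG₂₁, R₂⟩ := hE X d hd n₁ G₁ hG₁
  obtain ⟨n₃, G₃, L₃, hL₃, hG₃, hG₃₂, R₃⟩ := hH X d hd n₂ G₂ hG₂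
  -- the three open dense direction sets on the last probe `G₃`
  obtain ⟨U₁, hU₁o, hU₁d, hU₁⟩ := R₁ n₃ G₃ (L₃ ∘ₗ L₂) (hL₃.comp hL₂) hG₃
    (fun c ↦ by rw [LinearMap.comp_apply, hG₃₂, hG₂₁])
  obtain ⟨U₂, hU₂o, hU₂d, hU₂⟩ := R₂ n₃ G₃ L₃ hL₃ hG₃ hG₃₂
  obtain ⟨U₃, -, hU₃d, hU₃⟩ := R₃ n₃ G₃ LinearMap.id (fun _ _ h ↦ h) hG₃ (fun _ ↦ rfl)
  -- general position: a common direction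
  have hdense : Dense (U₁ ∩ U₂ ∩ U₃) :=
    (hU₁d.inter_of_isOpen_left hU₂d hU₁o).inter_of_isOpen_left hU₃d (hU₁o.inter hU₂o)
  obtain ⟨v, ⟨hv₁, hv₂⟩, hv₃⟩ := hdense.nonempty
  obtain ⟨δ₁, hδ₁, h₁⟩ := hU₁ v hv₁
  obtain ⟨δ₂, hδ₂, h₂⟩ := hU₂ v hv₂
  obtain ⟨δ₃, hδ₃, h₃⟩ := hU₃ v hv₃
  obtain ⟨hG₃s, hG₃0, hG₃adm, K, hK, hagree⟩ := hG₃
  have hproj : ContDiff ℝ ∞ (fun c : EuclideanSpace ℝ (Fin 1) ↦ c 0) :=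
    (contDiff_euclidean (𝕜 := ℝ) (ι := Fin 1) (n := ∞)
      (f := fun c : EuclideanSpace ℝ (Fin 1) ↦ c)).1 contDiff_id (0 : Fin 1)
  have hray : ContDiff ℝ ∞ (fun c : EuclideanSpace ℝ (Fin 1) ↦ (c 0) • v) :=
    hproj.smul contDiff_const
  refine ⟨fun c ↦ G₃ ((c 0) • v), ⟨hG₃s.comp_contDiff hray, ?_, fun c ↦ hG₃adm _, K, hK,
    fun c ↦ hagree _⟩, min δ₁ (min δ₂ δ₃), lt_min hδ₁ (lt_min hδ₂ hδ₃), fun c hc hcδ ↦ ?_⟩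
  · show G₃ (((0 : EuclideanSpace ℝ (Fin 1)) 0) • v) = d
    have h00 : ((0 : EuclideanSpace ℝ (Fin 1)) 0) = 0 := rfl
    rw [h00, zero_smul, hG₃0]
  · have hne : (c 0) ≠ 0 := hc.ne'
    have hlt : |c 0| < min δ₁ (min δ₂ δ₃) := by rwa [abs_of_pos hc]
    exact ⟨h₁ _ hne (hlt.trans_le (min_le_left _ _)),
      h₂ _ hne (hlt.trans_le ((min_le_right _ _).trans (min_le_left _ _))),
      h₃ _ hne (hlt.trans_le ((min_le_right _ _).trans (min_le_right _ _)))⟩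

/-- THE TRIM LEG — verbatim hypothesis `hT` of `modulatedKerrHandoff_of_core_trim` (= the registered
`stub_tameEndTrimming`, shared with ExactKerrEnds' item 18522). -/
def TameEndTrimming : Prop :=
  ∀ (X : Type) [TopologicalSpace X] [ChartedSpace E3 X] [IsManifold (𝓡 3) ((⊤ : ℕ∞) : WithTop ℕ∞) X]
    [T2Space X] [SecondCountableTopology X] [ConnectedSpace X],
    ∀ d ∈ admissibleVacuumData X, ∀ (e : AFEnd X) (M₀ : ℝ), e.IsSoleEnd →
      e.IsStronglyAsymptoticallyFlatDR d M₀ →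
        ∃ (R₀ : ℝ) (T : ℝ → InitialDataSet (𝓡 3) X) (M : ℝ → ℝ), IsTameTrimmingFamily X e d M₀ R₀ T M

/-- THE SOFT-ERA LIFT (H′-proper, pointwise, perturbative): a one-sided local kick family whose small
positive members are censored, carry a final era and have hyperbolic pairs, END-TRIMMED beyond a
threshold locally bounded along the family, hands off — the patched datum (`G c` inside `e.far R`,
`T R` outside) has a maximal development with the full 16-clause `HandoffClause`. Exactly hypothesis
`hU` of `modulatedKerrHandoff_of_core_trim` with `CoreHandoffProp` replaced by `ConjProp`. -/
def SoftEraLift : Prop :=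
  ∀ (X : Type) [TopologicalSpace X] [ChartedSpace E3 X] [IsManifold (𝓡 3) ((⊤ : ℕ∞) : WithTop ℕ∞) X]
    [T2Space X] [SecondCountableTopology X] [ConnectedSpace X],
    ∀ d ∈ admissibleVacuumData X,
      ∀ (G : EuclideanSpace ℝ (Fin 1) → InitialDataSet (𝓡 3) X) (δ : ℝ), IsLocalKick X d G → 0 < δ →
        (∀ c : EuclideanSpace ℝ (Fin 1), 0 < c 0 → c 0 < δ → ConjProp X (G c)) →
          ∀ (e : AFEnd X) (M₀ R₀ : ℝ) (T : ℝ → InitialDataSet (𝓡 3) X) (M : ℝ → ℝ),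
            e.IsSoleEnd → e.IsStronglyAsymptoticallyFlatDR d M₀ → IsTameTrimmingFamily X e d M₀ R₀ T M →
              ∃ ρ₁ : ℝ → ℝ, (∀ a b : ℝ, 0 < a → a ≤ b → b < δ → BddAbove (ρ₁ '' Icc a b)) ∧
                ∀ c : EuclideanSpace ℝ (Fin 1), 0 < c 0 → c 0 < δ → ∀ R : ℝ, R₀ ≤ R → ρ₁ (c 0) ≤ R →
                  ∀ D' ∈ admissibleVacuumData X,
                    (∀ x ∉ e.far R, D'.h.inner x = (G c).h.inner x ∧ D'.k x = (G c).k x) →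
                      (∀ x ∈ e.far R, D'.h.inner x = (T R).h.inner x ∧ D'.k x = (T R).k x) →
                        ∃ 𝒟 : VacuumCauchyDevelopment D', 𝒟.IsMaximal ∧ HandoffClause X D' 𝒟

-- operator-norm instance paths on form-valued maps are slow to unify (clause (QS))
set_option synthInstance.maxHeartbeats 400000 in
/-- **THE LINE'S COMPOSITION, kernel-checked**: trim leg, kick families with the conjunction, and
the soft-era lift give the crux `ModulatedKerrHandoff` BY NAME (via the landed
`exists_tameCurve_of_kick_trim` and `modulatedKerrHandoff_of_tameEscapeExists`). With
`ConjunctionGlue` in front, the stubs of the line are: `TameEndTrimming` (shared 18522),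
`CensorshipRobust'` (= RCG 10131), `EraRobust`, `HyperbolicRobust`, `SoftEraLift` — and the glue. -/
theorem modulatedKerrHandoff_of_clausewise (hT : TameEndTrimming) (hK : KicksWithConjunction)
    (hU : SoftEraLift) : Theses.EIHFluxBalance.ModulatedKerrHandoff := by
  refine modulatedKerrHandoff_of_tameEscapeExists fun X _ _ _ _ _ _ d hd _hP ↦ ?_
  obtain ⟨e, M₀, hsole, hDR⟩ := hd.2
  obtain ⟨R₀, T, M, hTrim⟩ := hT X d hd e M₀ hsole hDR
  obtain ⟨G, hG, δ, hδ, hgoodG⟩ := hK X d hd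
  obtain ⟨ρ₁, hbd, hgood⟩ := hU X d hd G δ hG hδ hgoodG e M₀ R₀ T M hsole hDR hTrim
  exact exists_tameCurve_of_kick_trim d e M₀ R₀ T M hsole hDR hTrim G hG hδ
    (locallyBdd_of_bddAbove_Icc hbd)
    (fun D' ↦ ∃ 𝒟 : VacuumCauchyDevelopment D', 𝒟.IsMaximal ∧ HandoffClause X D' 𝒟) hgood

/-- **THE FIVE STUBS CONCLUDE THE CRUX** (glue proved): trim leg (shared 18522), censorship robust
(= RCG 10131), era robust, wall robust, soft-era lift. -/
theorem modulatedKerrHandoff_of_robust (hT : TameEndTrimming)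
    (hB : CensorshipRobust') (hE : EraRobust) (hH : HyperbolicRobust) (hU : SoftEraLift) :
    Theses.EIHFluxBalance.ModulatedKerrHandoff :=
  modulatedKerrHandoff_of_clausewise hT (conjunctionGlue hB hE hH) hU

/-- The same with RCG's item 10131 BY NAME in the censorship slot. -/
theorem modulatedKerrHandoff_of_robust' (hT : TameEndTrimming)
    (hB : Theses.RobustClausewiseGenericity.CensorshipRobust) (hE : EraRobust) (hH : HyperbolicRobust)
    (hU : SoftEraLift) : Theses.EIHFluxBalance.ModulatedKerrHandoff :=
  modulatedKerrHandoff_of_robust hT (censorshipRobust'_iff.2 hB) hE hH hU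

end ClausewiseRobustEra

/-! ## Card 2 — `soft-era-tube-lift`: the far-cone engine's first lemma -/

namespace SoftEraTubeLift

/-- The flat d'Alembertian `∂ₜ²u − Δu` at `(t, x)`, via iterated one-dimensional derivatives (the
convention of the landed `LieDragResponseDecay`). -/
def dAlembert (u : ℝ → E3 → ℝ) (t : ℝ) (x : E3) : ℝ :=
  deriv (fun s ↦ deriv (fun s' ↦ u s' x) s) t -
    ∑ i : Fin 3, deriv (fun s : ℝ ↦ deriv (fun s' : ℝ ↦ u t (x + s' • EuclideanSpace.single i (1 : ℝ))) s) (0 : ℝ)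

/-- **FAR-CONE RETARDATION REMAINDER OF THE INSTANTANEOUS-BOOST ANSATZ** (flat `1+3` model of the
positive half of BN1; Liénard 1898 / Wiechert 1900, present-position expansion). Fix a smooth bump `φ`
supported in the unit ball, a speed bound `v < 1` and a cone aperture `κ' < 1`. There are `C, T₀` such
that: for every mass `M ≥ 0`, every `C³` worldline `ξ` anchored at `ξ 1 = 0` with speed `≤ v`,
acceleration `≤ A` and jerk `≤ A₃`, every `C²` function `u` with ZERO Cauchy data at `t = 1` solving
`∂ₜ²u − Δu = 4πM φ(x − ξ(t))` for `t ≥ 1` (the retarded field of the accelerated source switched on at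
`t = 1`; inside the cone `‖x‖ ≤ κ't`, `t ≥ T₀`, only source times `≥ 2` contribute), every lab time
`t₀ ≥ T₀`, and every `C²` TRAVELLING PROFILE `W → 0` at infinity whose translate along the TANGENT
worldline `s ↦ ξ(t₀) + (s − t₀)ξ̇(t₀)` solves the wave equation with the uniformly moving source (the
exact boosted potential with the INSTANTANEOUS position and velocity — the crux's ansatz for one hole,
`G(λ(t₀))`), one has at every cone point `‖x‖ ≤ κ't₀` with `‖x − ξ(t₀)‖ ≥ 2`:
`|u(t₀, x) − W(x − ξ(t₀))| ≤ C·M·(A + A₃·‖x − ξ(t₀)‖)`.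
Mechanism: the Liénard–Wiechert denominator `R_r(1 − n_r·v_r)` IS the present-position expression of
the tangent line AT THE RETARDED POINT, so the error is the sensitivity of the boosted potential
(`M/d²` in position, `M/d` in velocity) times the Taylor remainders `½Aτ² + A₃τ³/6`, `Aτ + A₃τ²/2`
(`τ = t₀ − s_r ≤ d/(1−v) + 1`); quadratic terms are absorbed using `|δv| ≤ 2v`. With `A ≍ M'/D(t)²`,
`A₃ ≍ M'/D(t)³` (EIH accelerations) and the weight `d^{7/4}`, `d ≤ κt`: weighted remainder
`≲ M M' t^{7/4}/D(t)²`, `→ 0` iff `D(t) ≫ t^{7/8}` — margin `t^{-1/4}` for HYPERBOLIC pairs, divergent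
(`t^{5/12}`; `t^{1/12}` after the centre-of-mass cancellation) for parabolic ones, as kit j005293
measured (`t^{-0.225}` vs `t^{+0.081}`). Size L (Kirchhoff formula for a moving bump; the tree's
`StubKirchhoffComparisonC2` / `StubRetardedConeEstimate` machinery). [folklore] -/
def FarConeRetardationRemainder : Prop :=
  ∀ (φ : E3 → ℝ) (v κ' : ℝ), ContDiff ℝ ((⊤ : ℕ∞) : WithTop ℕ∞) φ → (∀ y, 1 ≤ ‖y‖ → φ y = 0) →
    0 < v → v < 1 → 0 < κ' → κ' < 1 →
    ∃ C T₀ : ℝ, ∀ (M A A₃ : ℝ) (ξ : ℝ → E3), 0 ≤ M → 0 ≤ A → 0 ≤ A₃ →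
      ContDiff ℝ 3 ξ → ξ 1 = 0 → (∀ t, ‖deriv ξ t‖ ≤ v) → (∀ t, ‖iteratedDeriv 2 ξ t‖ ≤ A) →
      (∀ t, ‖iteratedDeriv 3 ξ t‖ ≤ A₃) →
      ∀ (u : ℝ → E3 → ℝ), ContDiff ℝ 2 (fun p : ℝ × E3 ↦ u p.1 p.2) →
        (∀ x, u 1 x = 0 ∧ deriv (fun s ↦ u s x) 1 = 0) →
        (∀ t x, 1 ≤ t → dAlembert u t x = 4 * Real.pi * M * φ (x - ξ t)) →
        ∀ (t₀ : ℝ), T₀ ≤ t₀ →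
          ∀ (W : E3 → ℝ), ContDiff ℝ 2 W → Tendsto W (cocompact E3) (𝓝 0) →
            (∀ t x, dAlembert (fun s y ↦ W (y - ξ t₀ - (s - t₀) • deriv ξ t₀)) t x =
              4 * Real.pi * M * φ (x - ξ t₀ - (t - t₀) • deriv ξ t₀)) →
            ∀ x : E3, ‖x‖ ≤ κ' * t₀ → 2 ≤ ‖x - ξ t₀‖ →
              |u t₀ x - W (x - ξ t₀)| ≤ C * M * (A + A₃ * ‖x - ξ t₀‖)

/-- **WEIGHTED FAR-CONE BOOKKEEPING** (the arithmetic that closes the `m = 0` clause in the far cone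
once `FarConeRetardationRemainder` holds per hole): if a pairwise separation is eventually linear,
`D(t) ≥ σt`, then the weighted per-hole remainder `(1 + d^{7/4})·M M'(1/D² + d/D³)` is uniformly
small on `d ≤ κt` for late `t` (it is `O(t^{-1/4})`). Pure real analysis, size S. [folklore] -/
def WeightedRemainderVanishes : Prop :=
  ∀ (M M' σ κ ε : ℝ), 0 ≤ M → 0 ≤ M' → 0 < σ → 0 < κ → 0 < ε →
    ∀ᶠ t : ℝ in atTop, ∀ d ∈ Set.Icc (0 : ℝ) (κ * t),
      (1 + Real.sqrt (Real.sqrt (d ^ 7))) * (M * M' * (1 / (σ * t) ^ 2 + d / (σ * t) ^ 3)) ≤ ε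

end SoftEraTubeLift

end Summit.FinalStateConjecture.FinalStateConjecture.Cruxes.ModulatedKerrHandoff

end
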